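import Summits.MatrixMultiplication.OmegaCensus.STPPVosperSlackTwoSoundAReduce
import Summits.MatrixMultiplication.OmegaCensus.STPP222SqSymmetry
import Summits.MatrixMultiplication.OmegaCensus.STPPDisjointPacking

/-!
# ω-census (abelian STPP census): the slack-2 partition law, cases A and B′ discharged by checker rows (kernel)

HONEST FRAMING (pub-omega census; verbatim): lottery ticket; floor = certified bounds/negative ranges.
Census STRUCTURE (seat pub-omega-stpp-1 gen 32, 2026-08-28), family (b2).  `slack_two_caseC_of_rows`: for a two-block STPP family of `ℤ/p` at slack 2
(block `i` of sizes `(a, b, c)`, the other block `(a₀, b₀, c₀)`, `L = b₀c₀`, `z = a₀c₀`, `z + b + abc + a + L = p`), if the case-A checker rows hold for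
every `b`-element shape (`caseADeadQ' p a c L z a₀ b₀ c₀ Q = true`, `Q ∈ qShapes p b …`) and for every `a`-element shape of the ROLE-SWAPPED family
(`caseADeadQ' p b c z L b₀ a₀ c₀ Q = true` — case B′ is case A of `(B, A, C)`, an STPP family by `stpp_rotate` + `isSTPP_swapBC`), then the block is in
case (C) of `slack_two_shapes`: both pairs exactly one above Cauchy–Davenport and `W ⊔ SY ⊔ T = ℤ/p`.  Soundness of the rows: `caseADeadQ'_false_of_isAP`
(`STPPVosperSlackTwoSoundAReduce.lean`) + `mem_qShapes_of_pairwise_lt`.  The case-C rows (`caseCDeadQP`) then finish the leaf — their soundness is the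
successor's item (`STPPVosperSlackTwoCheckersC.lean` has the control flow).  UNCONDITIONAL; no `decide`.  Nothing here is progress on `ω`.

References: H. Cohn, R. Kleinberg, B. Szegedy, C. Umans, FOCS 2005 (arXiv:math/0511460), Def. 5.1; A. G. Vosper, J. London Math. Soc. 31 (1956).
-/

open Finset
open scoped Pointwise

namespace Summit.MatrixMultiplication.OmegaCensus.CubeNB.S2

open Literature.Computability.AlgebraicComplexity
open Literature.Combinatorics.Additive
open Summit.MatrixMultiplication.OmegaCensus.STPPKneser
open Summit.MatrixMultiplication.OmegaCensus.CubeNB.Bits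

variable {p : ℕ} [hp : Fact p.Prime]

/-- The value list `((S.image fun x => (u·(x − x₀)).val).sort)` of a `b`-element set containing `x₀` is one of the enumerated shapes `qShapes p b …`
(`u ≠ 0`). [folklore] -/
theorem valShape_mem_qShapes {S : Finset (ZMod p)} {u x₀ : ZMod p} (hu : u ≠ 0) (hx₀ : x₀ ∈ S) {b : ℕ} (hb : #S = b) :
    ((S.image fun x => (u * (x - x₀)).val).sort (· ≤ ·)) ∈ qShapes p b 0 ((p - 1).choose (b - 1)) := by
  have hinj : Function.Injective fun x : ZMod p => (u * (x - x₀)).val := fun x x' h => by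
    have := mul_left_cancel₀ hu (ZMod.val_injective p h)
    simpa using this
  refine mem_qShapes_of_pairwise_lt _ (List.sortedLT_iff_pairwise.1 (Finset.sortedLT_sort _)) (fun q hq => ?_) ?_ ?_
  · rw [Finset.mem_sort, mem_image] at hq
    obtain ⟨x, _, rfl⟩ := hq
    exact ZMod.val_lt _
  · rw [Finset.mem_sort, mem_image]
    exact ⟨x₀, hx₀, by rw [sub_self, mul_zero, ZMod.val_zero]⟩
  · rw [Finset.length_sort, card_image_of_injective _ hinj, hb]

/-- **Slack-2 law, cases A and B′ by rows.**  See the module docstring. [cite: CohnKleinbergSzegedyUmans2005, Def. 5.1]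
[cite: Vosper1956, main theorem; Nathanson1996, Thm 2.7] -/
theorem slack_two_caseC_of_rows {A B C : Fin 2 → Finset (ZMod p)} (hS : IsSTPP A B C)
    (hA : ∀ k, (A k).Nonempty) (hB : ∀ k, (B k).Nonempty) (hC : ∀ k, (C k).Nonempty) (i i₀ : Fin 2) (hii : i₀ ≠ i)
    {a b c L z a₀ b₀ c₀ vol : ℕ} (ha : #(A i) = a) (hb : #(B i) = b) (hc : #(C i) = c) (ha₀ : #(A i₀) = a₀) (hb₀ : #(B i₀) = b₀)
    (hc₀ : #(C i₀) = c₀) (hL : b₀ * c₀ = L) (hz : a₀ * c₀ = z) (hvol : a * b * c = vol) (hslack : z + b + vol + a + L = p)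
    (h2a : 2 ≤ a) (h2b : 2 ≤ b) (h2z : 2 ≤ z) (h2L : 2 ≤ L)
    (rowsA : ∀ Q ∈ qShapes p b 0 ((p - 1).choose (b - 1)), caseADeadQ' p a c L z a₀ b₀ c₀ Q = true)
    (rowsB : ∀ Q ∈ qShapes p a 0 ((p - 1).choose (a - 1)), caseADeadQ' p b c z L b₀ a₀ c₀ Q = true) :
    #((A i).image (fun x => (0 : ZMod p) - x) + DU B C (univ.erase i)) = a + L ∧
      #((B i).image (fun x => (0 : ZMod p) - x) + DU A C (univ.erase i)) = b + z ∧
      (((A i) ×ˢ ((B i) ×ˢ (C i))).image fun q : ZMod p × ZMod p × ZMod p => (0 : ZMod p) + q.2.2 - q.1 - q.2.1) ∪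
          ((A i).image (fun x => (0 : ZMod p) - x) + DU B C (univ.erase i)) ∪
          ((B i).image (fun x => (0 : ZMod p) - x) + DU A C (univ.erase i)) = univ := by
  have hI : (univ : Finset (Fin 2)).erase i = {i₀} := by
    fin_cases i <;> fin_cases i₀ <;> first | exact absurd rfl hii | decide
  have hIne : ((univ : Finset (Fin 2)).erase i).Nonempty := by rw [hI]; exact singleton_nonempty _
  have hvol' : #(A i) * #(B i) * #(C i) = vol := by rw [ha, hb, hc, hvol]
  have hz' : ∑ k ∈ univ.erase i, #(A k) * #(C k) = z := by rw [hI, sum_singleton, ha₀, hc₀, hz]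
  have hL' : ∑ k ∈ univ.erase i, #(B k) * #(C k) = L := by rw [hI, sum_singleton, hb₀, hc₀, hL]
  rcases slack_two_shapes hS hA hB hC i hIne ha hb hvol' hz' hL' hslack h2a h2b h2z h2L with
    ⟨d, hd, hAP, hYAP, -, -⟩ | ⟨e, he, hBP, hZAP, -, -⟩ | h3
  · exfalso
    obtain ⟨β₀, hβ₀⟩ := hB i
    have key := caseADeadQ'_false_of_isAP hS hA hB hC i i₀ hii ha hc ha₀ hb₀ hc₀ hL hz (by omega) hd hAP hYAP hβ₀
    rw [rowsA _ (valShape_mem_qShapes (inv_ne_zero hd) hβ₀ hb)] at key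
    exact Bool.noConfusion key
  · exfalso
    have hS' : IsSTPP B A C := STPP222SqNeg.isSTPP_swapBC (stpp_rotate hS)
    obtain ⟨α₀, hα₀⟩ := hA i
    have key := caseADeadQ'_false_of_isAP hS' hB hA hC i i₀ hii hb hc hb₀ ha₀ hc₀ hz hL (by omega) he hBP hZAP hα₀
    rw [rowsB _ (valShape_mem_qShapes (inv_ne_zero he) hα₀ ha)] at key
    exact Bool.noConfusion key
  · exact h3

end Summit.MatrixMultiplication.OmegaCensus.CubeNB.S2
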